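import Summits.BirchSwinnertonDyer.BirchSwinnertonDyer.Theorems.KimAtThreeDeepUpperNonAdditiveAllOfFineKato
import Summits.BirchSwinnertonDyer.BirchSwinnertonDyer.Theorems.KimAtThreeDeepUpperCertSupplyNonAdditive
import Summits.BirchSwinnertonDyer.BirchSwinnertonDyer.Theorems.KimAtThreeDeepUpperAdditiveDefectOfFineKatoOnly
import Summits.BirchSwinnertonDyer.BirchSwinnertonDyer.Theorems.KimAtThreeDeepUpperSplitGlueFineKatoU
import HarnessLib

/-!
# Route `KimAtThreeKolyvagin` (rung W2): crux `DeepUpperAtThreeOffKatoStratum` (19562) BY NAME and crux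
# `DeepUpperAtThree` (19076) BY NAME from PUBLISHED inputs + Kato's FINE PACKAGES at `3` ONLY — the
# Kolyvagin-system road at every reduction type; NO (DD), NO Wuthrich / BSD₃ input anywhere
# (cell `bsd-addord`, seat w2-c3 gen 6)

HONEST FRAMING: glue theorems with DISPLAYED hypotheses (no definition, no named fact, no `sorry`); every
conclusion is a route decl BY NAME but CONDITIONAL on the displayed fine Kato packages, so NOTHING is closed and
nothing is booked; BSD is not proved by any of this.

## What, and why

Before this session crux 19562's NON-ADDITIVE rows (good / multiplicative `3`, tower onto) were reached only via
Wuthrich 2014 Prop. 21 / the BSD₃ upper half and the displayed OPEN statement (DD)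
`∂^{(∞)}_{deep}(δ̃) ≤ v₃(∏ c_ℓ)` (Kim 2022 Conj. 1.10 ≤-half).  This seat (gen 6) ran the Kolyvagin-system road
there instead (THEOREM D-u on the torsion-stabilisation binder; the `3`-Euler factor of Kato's depleted
`L`-value absorbed into the twist; the anomalous augmentation `3·unit` moved to the Kurihara exponent; seat
w2-acc1's reduction-free END) and proved the registered stub `stub_nonAdditive` VERBATIM from S24-DEEP ×2 +
GZK + PT + (C1₃) + (C2₃′), then (C2₃′) class-wide (`certSupply₃'`).  Seat w2-acc1 proved `stub_additiveDefect`
VERBATIM from the same published inputs + (C1ₜₑ) + (C2), with (C2) class-wide (`certSupply_allDefectRows`, via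
this seat's gen-5 `certSupply_of_addv`).  This file composes:
* ★ `deepUpperAtThreeOffKatoStratum_of_deepFacts_of_fineKatos` — **crux 19562 BY NAME ⟸ S24-DEEP ×2, GZK,
  Poitou–Tate, (C1ₜₑ) (additive-defect rows), (C1₃) (non-additive rows)** — the planner's registered case
  split `DeepUpperAtThreeOffKatoStratum_of` re-proved inline over the two stubs.  NO (DD), NO (U′), NO
  Wuthrich / Kato 14.5(3) / BSD₃ input, NO certificate hypothesis, NO Manin / period / `c₃` / torsion binder.
* ★ `deepUpperAtThree_of_pub_of_fineKatos` — **crux 19076 `DeepUpperAtThree` BY NAME ⟸ the route's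
  PUBLISHED leaves (Sakamoto ×2, S24-DEEP ×2, GZK, Poitou–Tate, Carayol) + THREE displayed fine Kato packages:
  ⟨C1⟩ on the Kato stratum (gen 5 / kim3 shape), (C1ₜₑ) on the additive-defect rows (acc1/acc6 shape),
  (C1₃) on the non-additive rows (this seat's shape)** — gen 5's `deepUpperAtThree_of_pub_of_fineKato_of_off`
  with its `hOff` produced by ★.  The three packages are ONE object in three coordinates (Kato's Euler system
  of `T₃E` read through the Bloch–Kato dual exponential at a finite level: `Λ = exp*_ω`, rider (ii) at
  `(0,0)`; `Λ = exp*_ω`, rider (ii₂) at `(t, v₃(c₃)+v₃(c_P))`; `Λ = 3·exp*_ω`, rider (ii₂) at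
  `(0, v₃(#Ẽ_ns·c₃) − τ)`) — the planner's definition item `defn-BlochKatoDualExponential`.
HONEST LIMITS: the packages are construction-shaped (axioms on bound witnesses, never `_holds`); the PUB leaves
are cite-only named facts; nothing is closed; BSD is not proved.
References: [Kato2004Asterisque] (8.1.3), Prop. 8.12, §9.4, Thm. 9.7, Thm. 6.6 (1), Ex. 13.3;
[Kim2022StructureSelmer] Lemma 3.4, Thm. 3.13, §2.2.2; [Kim2025RefinedTNC] Thm 1.1; [MazurRubin2004] Thm. 3.2.4,
5.2.12, App. A; [Sakamoto2024] Thm. 4.4; [MilneADT2006] I.4.10; kim3 memo KIM3-W2-C1-g11; acc1 memo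
W2ACC1-PORTE-19562; this seat's memo W2C3-UNIFORM-PORT-g6.
-/

set_option autoImplicit false
-- the Theorems namespace of a single-conjunct summit repeats the summit name by design (D-0017)
set_option linter.dupNamespace false

noncomputable section

open scoped NumberField TensorProduct ContRepresentation Classical
open CategoryTheory Field Function Finset IsDedekindDomain NumberField WeierstrassCurve
open Rat.HeightOneSpectrum CongruenceSubgroup
open Literature.NumberTheory.GaloisRepresentations Literature.NumberTheory.GaloisCohomology
open Literature.NumberTheory.GaloisRepresentations.DiscreteGaloisModule
open Literature.NumberTheory.EllipticCurves Literature.NumberTheory.EllipticCurves.ModularForms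
open Literature.NumberTheory.EllipticCurves.Rank1Residual
open Literature.NumberTheory.EllipticCurves.Kato2004
open Literature.NumberTheory.EllipticCurves.Kato2004.EulerSystemValues
open Summit.BirchSwinnertonDyer.Rank1Residual.GaloisImage
open Summit.BirchSwinnertonDyer.BirchSwinnertonDyer.Theses.KimAtThreeKolyvagin
open Summit.BirchSwinnertonDyer.BirchSwinnertonDyer.Theorems

namespace Summit.BirchSwinnertonDyer.BirchSwinnertonDyer.Theorems.KimAtThreeDeepUpperOfFineKatos

/-- Local notation: the TWO-EXPONENT rider clause (ii₂) at depth `j`, torsion exponent `t`, defect exponent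
`e`, place `v`, for the pair `(Λ, Λf)` — seat acc6's spelling (`KimAtThreeTwoExponentWitnessPair`). -/
local notation3 (prettyPrint := false) "RIDER₂⟦" W' ", " j ", " t' ", " e' ", " v' ", " Λ' ", " Λf "⟧" =>
  ∀ (r : Finset (HeightOneSpectrum (𝓞 ℚ)))
    (Ψ : H1 (tateRep W' 3) (cycSubgroup 3 0 r) →+
      continuousCohomology 1
        (subgroupRep (WeierstrassCurve.torsionGaloisModule W' (((3 : ℕ) : ℤ) ^ j * ((3 : ℕ) : ℤ))).toTopRep
          (cycSubgroup 3 0 r))),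
    (∀ (φ : contOneCocycles (subgroupRep (tateRep W' 3).toTopRep (cycSubgroup 3 0 r)))
        (ψ : contOneCocycles
          (subgroupRep (WeierstrassCurve.torsionGaloisModule W' (((3 : ℕ) : ℤ) ^ j * ((3 : ℕ) : ℤ))).toTopRep
            (cycSubgroup 3 0 r))),
        (∀ g, ((ψ.1 g : geomTorsion W' (((3 : ℕ) : ℤ) ^ j * ((3 : ℕ) : ℤ))) : geomPoints W') =
          TateModule.proj 3 (j + 1) (φ.1 g)) →
        Ψ (oneCocycleClass _ φ) = oneCocycleClass _ ψ) →
    ∀ (y : H1 (tateRep W' 3) (cycSubgroup 3 0 r))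
      (κ₀ : galoisCohomology (WeierstrassCurve.torsionGaloisModule W' (((3 : ℕ) : ℤ) ^ j * ((3 : ℕ) : ℤ))) 1)
      (s : ℤ_[3]),
      resSubgroup (WeierstrassCurve.torsionGaloisModule W' (((3 : ℕ) : ℤ) ^ j * ((3 : ℕ) : ℤ))).toTopRep
          (cycSubgroup 3 0 r) 1 κ₀ = Ψ y →
      galoisCohomology.localization (WeierstrassCurve.torsionGaloisModule W' (((3 : ℕ) : ℤ) ^ j * ((3 : ℕ) : ℤ)))
          (Sum.inr v') 1 κ₀ ∈ propagatedSelmerStructure W' 3 j (Sum.inr v') →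
      (∃ l ∈ cycIntLattice 3 (cycLevel 3 0 r),
          (((3 : ℕ) : ℤ_[3]) ^ t') • Λ' 0 r y - ((s : ℚ_[3]) ⊗ₜ[ℚ] (1 : CyclotomicField (cycLevel 3 0 r) ℚ)) =
            (((3 : ℕ) : ℤ_[3]) ^ (j + 1)) • (l : ℚ_[3] ⊗[ℚ] CyclotomicField (cycLevel 3 0 r) ℚ)) →
      ((3 ^ e' : ℕ) : ZMod (3 ^ (j + 1))) *
        Λf (galoisCohomology.localization
          (WeierstrassCurve.torsionGaloisModule W' (((3 : ℕ) : ℤ) ^ j * ((3 : ℕ) : ℤ))) (Sum.inr v') 1 κ₀) =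
        PadicInt.toZModPow (j + 1) s

variable
  -- (C1ₜₑ) the fine Kato package on the ADDITIVE-DEFECT rows (seat w2-acc1 / w2-acc6 shape)
  (hC1te : ∀ (W : WeierstrassCurve ℚ) [W.IsElliptic] [W.IsGloballyMinimal]
    [ContinuousSMul ℤ_[3] (W.tateModule 3)] [Module.Free ℤ_[3] (W.tateModule 3)]
    [Module.Finite ℤ_[3] (W.tateModule 3)],
    (∀ m : ℕ, W.HasSurjectiveModNGaloisRep (3 ^ m : ℕ)) →
    (haveI : Fact (Nat.Prime 3) := ⟨Nat.prime_three⟩; Addv W 3) →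
    ∀ (v₃ : HeightOneSpectrum (𝓞 ℚ)), ((3 : ℕ) : 𝓞 ℚ) ∈ v₃.asIdeal →
    ∀ {N : ℕ} [NeZero N] (P : ModularParametrizationData W N), N = W.conductorNorm ℤ →
      (∀ z ∈ P.L.lattice, ∃ w ∈ periodLattice P.f, z = P.c * w) →
      (3 ∣ (W.baseChange ℚ_[3]).localTamagawaNumber ℤ_[3] ∨
        Nat.card {Q : (W.baseChange ℚ_[3]).toAffine.Point // (3 : ℕ) • Q = 0} ≠ 1 ∨
        (3 : ℤ) ∣ P.maninConstant) →
      ∃ (t e : ℕ) (ι : (n : ℕ) → (CyclotomicField n ℚ →+* ℂ)) (κK : ℝ)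
        (Λ : ∀ (k' : ℕ) (r : Finset (HeightOneSpectrum (𝓞 ℚ))),
          H1 (tateRep W 3) (cycSubgroup 3 k' r) →ₗ[ℤ_[3]] ℚ_[3] ⊗[ℚ] CyclotomicField (cycLevel 3 k' r) ℚ)
        (Λfin : ∀ j : ℕ, galoisCohomology
          ((W.torsionGaloisModule (((3 : ℕ) : ℤ) ^ j * ((3 : ℕ) : ℤ))).toLocal (Sum.inr v₃)) 1 →+
            ZMod (3 ^ (j + 1))),
        κK ≠ 0 ∧ (∃ u : ℚ, (u : ℝ) = κK ∧ padicValRat 3 u = 0) ∧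
        (∀ j : ℕ,
          (∀ c : ZMod (3 ^ (j + 1)), ∃ x ∈ propagatedSelmerStructure W 3 j (Sum.inr v₃), Λfin j x = c) ∧
          (∀ x ∈ propagatedSelmerStructure W 3 j (Sum.inr v₃),
            Λfin j x = 0 ↔ x ∈ W.kummerSelmerStructure (((3 : ℕ) : ℤ) ^ j * ((3 : ℕ) : ℤ)) (Sum.inr v₃))) ∧
        (∀ j : ℕ, RIDER₂⟦W, j, t, e, v₃, Λ, Λfin j⟧) ∧
        ∀ (c d a : ℤ) (A : ℕ), 0 < A → Int.gcd c (6 * 3 * A) = 1 → Int.gcd d (6 * 3 * N) = 1 →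
          ∃ (z : ∀ (k' : ℕ) (r : (cyclotomicLevelsRat 3 (badPlaces c d A N)).Ideals),
                H1 (tateRep W 3) ((cyclotomicLevelsRat 3 (badPlaces c d A N)).level k' r.1))
            (x : ∀ (k' : ℕ) (r : (cyclotomicLevelsRat 3 (badPlaces c d A N)).Ideals),
                CyclotomicField (cycLevel 3 k' r.1) ℚ),
            ZetaBody W 3 P.f ι κK Λ c d a A z x)
  (hC1₃ : ∀ (W : WeierstrassCurve ℚ) [W.IsElliptic] [W.IsGloballyMinimal]
    [ContinuousSMul ℤ_[3] (W.tateModule 3)] [Module.Free ℤ_[3] (W.tateModule 3)]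
    [Module.Finite ℤ_[3] (W.tateModule 3)],
    (∀ m : ℕ, W.HasSurjectiveModNGaloisRep (3 ^ m : ℕ)) →
    ¬ (haveI : Fact (Nat.Prime 3) := ⟨Nat.prime_three⟩; Addv W 3) →
    ∀ (v₃ : HeightOneSpectrum (𝓞 ℚ)), ((3 : ℕ) : 𝓞 ℚ) ∈ v₃.asIdeal →
    ∀ {N : ℕ} [NeZero N] (P : ModularParametrizationData W N), N = W.conductorNorm ℤ →
      (∀ z ∈ P.L.lattice, ∃ w ∈ periodLattice P.f, z = P.c * w) →
      ∃ (t e : ℕ) (ι : (n : ℕ) → (CyclotomicField n ℚ →+* ℂ)) (κK : ℝ)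
        (Λ : ∀ (k' : ℕ) (r : Finset (HeightOneSpectrum (𝓞 ℚ))),
          H1 (tateRep W 3) (cycSubgroup 3 k' r) →ₗ[ℤ_[3]] ℚ_[3] ⊗[ℚ] CyclotomicField (cycLevel 3 k' r) ℚ)
        (Λfin : ∀ j : ℕ, galoisCohomology
          ((W.torsionGaloisModule (((3 : ℕ) : ℤ) ^ j * ((3 : ℕ) : ℤ))).toLocal (Sum.inr v₃)) 1 →+
            ZMod (3 ^ (j + 1))),
        κK ≠ 0 ∧ (∃ u : ℚ, (u : ℝ) = κK ∧ padicValRat 3 u = 1) ∧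
        (∀ j : ℕ,
          (∀ c : ZMod (3 ^ (j + 1)), ∃ x ∈ propagatedSelmerStructure W 3 j (Sum.inr v₃), Λfin j x = c) ∧
          (∀ x ∈ propagatedSelmerStructure W 3 j (Sum.inr v₃),
            Λfin j x = 0 ↔ x ∈ W.kummerSelmerStructure (((3 : ℕ) : ℤ) ^ j * ((3 : ℕ) : ℤ)) (Sum.inr v₃))) ∧
        (∀ j : ℕ, RIDER₂⟦W, j, t, e, v₃, Λ, Λfin j⟧) ∧
        ∀ (c d a : ℤ) (A : ℕ), 0 < A → Int.gcd c (6 * 3 * A) = 1 → Int.gcd d (6 * 3 * N) = 1 →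
          ∃ (z : ∀ (k' : ℕ) (r : (cyclotomicLevelsRat 3 (badPlaces c d A N)).Ideals),
                H1 (tateRep W 3) ((cyclotomicLevelsRat 3 (badPlaces c d A N)).level k' r.1))
            (x : ∀ (k' : ℕ) (r : (cyclotomicLevelsRat 3 (badPlaces c d A N)).Ideals),
                CyclotomicField (cycLevel 3 k' r.1) ℚ),
            ZetaBody W 3 P.f ι κK Λ c d a A z x)

include hC1te hC1₃

/-- ★ **Crux `DeepUpperAtThreeOffKatoStratum` (stmt-BirchSwinnertonDyer-19562) BY NAME from S24-DEEP ×2, GZK,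
Poitou–Tate and the two fine Kato packages (C1ₜₑ) + (C1₃); the certificate supplies are theorems
(`certSupply_allDefectRows`, `certSupply₃'`).**  The planner's registered composition
`DeepUpperAtThreeOffKatoStratum_of stub_nonAdditive stub_additiveDefect`, inlined.  NO (DD), NO Wuthrich / BSD₃
input.  Conditional; nothing is booked. [cite: Kim2025RefinedTNC, Thm. 1.1] [cite: Sakamoto2024, Thm. 4.4 (p. 926)]
[cite: Kato2004Asterisque, (8.1.3) (p. 180), §9.4 and Thm. 9.7 (pp. 188–189), Ex. 13.3 (pp. 224–225)]
[cite: MilneADT2006, Ch. I, Thm. 4.10] -/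
theorem deepUpperAtThreeOffKatoStratum_of_deepFacts_of_fineKatos
    (hS24d : S24Deep.kolyvaginSystems_freeRankOne_zmod_three_pow_deep)
    (hS24d₂ : S24Deep.kolyvaginSystems_idealOfBasis_eq_fittingIdeal_zmod_three_pow_deep)
    (hGZK : rank_eq_analyticRank_of_analyticRank_le_one)
    (hPT : poitouTate_selmerStructure_duality ℚ) :
    DeepUpperAtThreeOffKatoStratum := by
  intro W₀ _ _ htow hfin N _ hN D₀ hopt hdeg hint hord hoff
  by_cases hA : (haveI : Fact (Nat.Prime 3) := ⟨Nat.prime_three⟩; Addv W₀ 3)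
  · refine KimAtThreeDeepUpperAdditiveDefectOfFineKato.stub_additiveDefect_of_deepFacts_of_fineKatoTwoExp_of_certSupply
      hC1te KimAtThreeDeepUpperAdditiveDefectOfFineKatoOnly.certSupply_allDefectRows hS24d hS24d₂ hGZK hPT W₀
      htow hfin hN D₀ hopt hdeg hint hord hA ?_
    by_contra hcon
    push Not at hcon
    exact hoff ⟨hA, hcon.1, hcon.2.1, hcon.2.2⟩
  · exact KimAtThreeDeepUpperNonAdditiveAllOfFineKato.stub_nonAdditive_of_deepFacts_of_fineKato₃_of_certSupply₃'
      hC1₃ KimAtThreeDeepUpperCertSupplyNonAdditive.certSupply₃' hS24d hS24d₂ hGZK hPT W₀ htow hfin hN D₀ hopt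
      hdeg hint hord hA

/-- ★ **Crux `DeepUpperAtThree` (stmt-BirchSwinnertonDyer-19076) BY NAME from the route's PUBLISHED leaves and
THREE displayed fine Kato packages only** — gen 5's `deepUpperAtThree_of_pub_of_fineKato_of_off` (Kato stratum:
Sakamoto ×2, GZK, Poitou–Tate, Carayol + ⟨C1⟩, with (C2) and (C3) discharged) fed the off-stratum crux from ★
(S24-DEEP ×2 + (C1ₜₑ) + (C1₃)).  Conditional; nothing is booked.
[cite: Kim2025RefinedTNC, Thm. 1.1] [cite: Sakamoto2024, Thm. 4.4 (p. 926)]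
[cite: Kato2004Asterisque, (8.1.3) (p. 180), Prop. 8.12 (p. 186), §9.4 and Thm. 9.7 (pp. 188–189), Thm. 6.6 (1) (p. 163), Ex. 13.3 (pp. 224–225)]
[cite: MazurRubin2004, Thm. 5.2.12 and App. A Remark A.5] [cite: MilneADT2006, Ch. I, Thm. 4.10] -/
theorem deepUpperAtThree_of_pub_of_fineKatos
    (hSak : SakamotoKolyvaginThree) (hGZK : RankEqAnalyticRankLeOne)
    (hPT : PoitouTateSelmerDuality) (hlev : CarayolLevelEqConductor)
    (hS24d : S24Deep.kolyvaginSystems_freeRankOne_zmod_three_pow_deep)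
    (hS24d₂ : S24Deep.kolyvaginSystems_idealOfBasis_eq_fittingIdeal_zmod_three_pow_deep)
    (hC1 : ∀ (W : WeierstrassCurve ℚ) [W.IsElliptic] [W.IsGloballyMinimal]
      [ContinuousSMul ℤ_[3] (W.tateModule 3)] [Module.Free ℤ_[3] (W.tateModule 3)]
      [Module.Finite ℤ_[3] (W.tateModule 3)],
      (∀ m : ℕ, W.HasSurjectiveModNGaloisRep (3 ^ m : ℕ)) →
      (haveI : Fact (Nat.Prime 3) := ⟨Nat.prime_three⟩; Addv W 3) →
      ¬ 3 ∣ (W.baseChange ℚ_[3]).localTamagawaNumber ℤ_[3] →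
      Nat.card {Q : (W.baseChange ℚ_[3]).toAffine.Point // (3 : ℕ) • Q = 0} = 1 →
      ∀ (v₃ : HeightOneSpectrum (𝓞 ℚ)), ((3 : ℕ) : 𝓞 ℚ) ∈ v₃.asIdeal →
      ∀ {N : ℕ} [NeZero N] (P : ModularParametrizationData W N), N = W.conductorNorm ℤ →
        (∀ z ∈ P.L.lattice, ∃ w ∈ periodLattice P.f, z = P.c * w) →
        ¬ (3 : ℤ) ∣ P.maninConstant →
        ∃ (ι : (n : ℕ) → (CyclotomicField n ℚ →+* ℂ)) (κK : ℝ)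
          (Λ : ∀ (k' : ℕ) (r : Finset (HeightOneSpectrum (𝓞 ℚ))),
            H1 (tateRep W 3) (cycSubgroup 3 k' r) →ₗ[ℤ_[3]]
              ℚ_[3] ⊗[ℚ] CyclotomicField (cycLevel 3 k' r) ℚ)
          (Λfin : ∀ j : ℕ, galoisCohomology
            ((W.torsionGaloisModule (((3 : ℕ) : ℤ) ^ j * ((3 : ℕ) : ℤ))).toLocal (Sum.inr v₃)) 1 →+
              ZMod (3 ^ (j + 1))),
          κK ≠ 0 ∧ (∃ u : ℚ, (u : ℝ) = κK ∧ padicValRat 3 u = 0) ∧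
          (∀ j : ℕ, KatoExpStarFiniteLevelAt W 3 j 0 v₃ Λ (Λfin j)) ∧
          ∀ (c d a : ℤ) (A : ℕ), 0 < A → Int.gcd c (6 * 3 * A) = 1 → Int.gcd d (6 * 3 * N) = 1 →
            ∃ (z : ∀ (k' : ℕ) (r : (cyclotomicLevelsRat 3 (badPlaces c d A N)).Ideals),
                  H1 (tateRep W 3) ((cyclotomicLevelsRat 3 (badPlaces c d A N)).level k' r.1))
              (x : ∀ (k' : ℕ) (r : (cyclotomicLevelsRat 3 (badPlaces c d A N)).Ideals),
                  CyclotomicField (cycLevel 3 k' r.1) ℚ),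
              ZetaBody W 3 P.f ι κK Λ c d a A z x) :
    Summit.BirchSwinnertonDyer.BirchSwinnertonDyer.Theses.KimAtThreeKolyvagin.DeepUpperAtThree :=
  KimAtThreeDeepUpperSplitGlueFineKatoU.deepUpperAtThree_of_pub_of_fineKato_of_off hSak hGZK hPT hlev hC1
    (deepUpperAtThreeOffKatoStratum_of_deepFacts_of_fineKatos hC1te hC1₃ hS24d hS24d₂ hGZK hPT)

end Summit.BirchSwinnertonDyer.BirchSwinnertonDyer.Theorems.KimAtThreeDeepUpperOfFineKatos

end
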